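import Summits.NavierStokesRegularity.NavierStokesRegularity.Theorems.DssFarFieldSlavingBlowupTypeIDssProfileSimilarityEnstrophyBeltramiLiouville
import HarnessLib

/-!
# Route SymmetryModuliCount — the target `TypeIAncientLiouville` (stmt-NavierStokesRegularity-4050,
  (L') in the KNSS gauge) BELOW THE RATE `1` and on the GENERALISED-BELTRAMI cell

The target (L') asks that every element of `A_C` — fields smooth on `(−∞,0) × ℝ³`, divergence
free, KNSS-mild (Oseen integral equation between all pairs of negative times), with
`|u(t,x)| ≤ C/√(−t)` — vanishes, for EVERY `C`. The cell pub-ns-dss's T31⁗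
(`SimilarityEnstrophy.typeI_ancient_eq_zero_of_rate_lt_one`) is (L') for all `C < 1`, with no
spatial hypothesis, and its T33 endpoint (`SimilarityEnstrophy.typeI_ancient_eq_zero_of_generalisedBeltrami`)
is (L') at ANY `C` on the sub-class with curl-free Lamb vector. This file records both in the
route's INLINE vocabulary (the literal hypothesis of `Theses.SymmetryModuliCount.TypeIAncientLiouville`,
bridged by `isTypeIAncientMild_iff`), as partial results towards the open target. Nothing is
claimed at `C ≥ 1` off the Beltrami cell — that is the hard core (KNSS Conjecture (L) restricted to
the Type-I class).

HONEST FRAMING: exclusion statements about HYPOTHETICAL Type-I ancient mild fields; nothing here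
bears on Navier–Stokes regularity. Lands `--supports stmt-NavierStokesRegularity-4050`.
-/

noncomputable section

namespace Summit.NavierStokesRegularity.NavierStokesRegularity.Theorems

set_option linter.dupNamespace false

open MeasureTheory Set Function
open Literature.Analysis Literature.Analysis.FluidPDE
open Summit.NavierStokesRegularity.NavierStokesRegularity.Theorems.SimilarityEnstrophy

/-- **(L') below the rate `1`**: every element of the route's class `A_C` with `C < 1` vanishes
identically on `t < 0` — the literal hypothesis of `Theses.SymmetryModuliCount.TypeIAncientLiouville`
restricted to `C < 1` (T31⁗ of cell pub-ns-dss through `isTypeIAncientMild_iff`). [this file] -/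
theorem symmetryModuliCount_typeIAncientLiouville_of_lt_one :
    ∀ (C : ℝ), C < 1 → ∀ (u : ℝ → EuclideanSpace ℝ (Fin 3) → EuclideanSpace ℝ (Fin 3)),
      ContDiffOn ℝ (⊤ : ℕ∞) (Function.uncurry u) (Set.Iio 0 ×ˢ Set.univ) ∧
        (∀ t < 0, Literature.Analysis.FluidPDE.VectorCalculus.IsDivFree (u t)) ∧
        (∀ s t : ℝ, s < t → t < 0 → ∀ x, u t x = Literature.Analysis.FluidPDE.heatFlow (u s) (t - s) x -
          ∫ τ in Set.Ioo s t, ∫ y, Literature.Analysis.FluidPDE.oseenKernel (t - τ) (x - y) (u τ y) (u τ y)) ∧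
        Literature.Analysis.FluidPDE.HasTypeITimeDecay C u →
      ∀ t < 0, ∀ x, u t x = 0 := by
  intro C hC u hu
  exact typeI_ancient_eq_zero_of_rate_lt_one (isTypeIAncientMild_iff.2 hu) hC

/-- **(L') on the generalised-Beltrami cell, ANY `C`**: every element of `A_C` whose Lamb vector is
curl-free at every negative time (`curl (curl u(t) × u(t)) ≡ 0`) vanishes identically on `t < 0`
(T33 endpoint of cell pub-ns-dss through `isTypeIAncientMild_iff`). [this file] -/
theorem symmetryModuliCount_typeIAncientLiouville_of_generalisedBeltrami :
    ∀ (C : ℝ) (u : ℝ → EuclideanSpace ℝ (Fin 3) → EuclideanSpace ℝ (Fin 3)),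
      ContDiffOn ℝ (⊤ : ℕ∞) (Function.uncurry u) (Set.Iio 0 ×ˢ Set.univ) ∧
        (∀ t < 0, Literature.Analysis.FluidPDE.VectorCalculus.IsDivFree (u t)) ∧
        (∀ s t : ℝ, s < t → t < 0 → ∀ x, u t x = Literature.Analysis.FluidPDE.heatFlow (u s) (t - s) x -
          ∫ τ in Set.Ioo s t, ∫ y, Literature.Analysis.FluidPDE.oseenKernel (t - τ) (x - y) (u τ y) (u τ y)) ∧
        Literature.Analysis.FluidPDE.HasTypeITimeDecay C u →
      (∀ t < 0, ∀ x, curl (fun y => cross (curl (u t) y) (u t y)) x = 0) →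
      ∀ t < 0, ∀ x, u t x = 0 := by
  intro C u hu hbel
  exact typeI_ancient_eq_zero_of_generalisedBeltrami (isTypeIAncientMild_iff.2 hu) hbel

end Summit.NavierStokesRegularity.NavierStokesRegularity.Theorems

end
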